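import Literature.NumberTheory.Transcendental.CijsouwWaldschmidt1977Setup
import Literature.NumberTheory.Transcendental.PadicLogPrincipalUnits
import HarnessLib

/-!
# The `p`-adic Cijsouw–Waldschmidt set-up over `ℚ_p`: data, rational cores, logarithms

Support file (definitions and proved theorems; no named fact) for the kernel `p`-adic bound for
linear forms in logarithms of rational principal units (cell `abc-stewartyu`, blueprint
`PADIC-CORE.md` §3, work package WP-A2): the port to the place `p` of the tree's archimedean
Cijsouw–Waldschmidt 1977 / Waldschmidt 1980 `2`-descent (`CijsouwWaldschmidt1977Setup.lean`,
`CW77.Setup`), following Yu's `p`-adic method (*Linear forms in p-adic logarithms II*,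
Compositio Math. 74 (1990), §§1–3: the `p`-adic exponential and logarithm on principal units,
the auxiliary functions `exp(z · ∑ λⱼ log_p αⱼ)` on a disc of radius `> 1`).

## The data (`PadicCW77.Setup`)

An ODD prime `p`; `d` "free" rationals `α₁, …, α_d` and the eliminated rational `θ`, all
PRINCIPAL UNITS `≡ 1 (mod p)` (`1 ≤ ord_p(αⱼ − 1)`; they may be NEGATIVE — the sign-normalised
generators of the reduction step `PadicLogFormsKummerFree.lean` are forced to be negative when
`−1 ∈ ⟨q₁, …, q_m⟩ ≤ (ℤ/p)ˣ`, which is why `CW77.Setup`, whose generators are positive, is not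
instantiated but TWINNED); integers `bⱼ` and `b_θ ≠ 0` with `ord_p b_θ ≤ ord_p bⱼ` for all `bⱼ ≠ 0` (Yu's normalisation:
the eliminated logarithm carries the coefficient of minimal `p`-adic order, so that the
`βⱼ = −bⱼ/b_θ` are `p`-adic integers; any index of minimal order will do). The linear form is
`Λ = ∑ bⱼ log_p αⱼ + b_θ log_p θ = log_p (∏ αⱼ^{bⱼ} θ^{b_θ})`, `Λ₀ = −Λ/b_θ = ∑ βⱼ log_p αⱼ − log_p θ`,
`βⱼ = −bⱼ/b_θ ∈ ℤ_p`; `‖Λ‖ = ‖b_θ‖_p ‖Λ₀‖ ≤ ‖Λ₀‖`.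

## What is generator-free is imported, what involves the generators is twinned

All the bookkeeping of `CW77.Setup` that involves only `d, b, b_θ` — indices `Idx`, multi-orders
`Tau`, `βⱼ`, `γⱼ(u) = λⱼ + λ_θ βⱼ`, the rational `Δ`-values `qΔ`, `qA = ∏ γⱼ^{τ'ⱼ}` — is used
through the **frame** `S.frame : CW77.Setup` (same `d, b, b_θ`, unit generators). The
generator-dependent rational cores are twinned verbatim: `qE(u,s) = ∏ αⱼ^{λⱼ s} θ^{λ_θ s}`,
`qTerm = qΔ · qA · qE`, `coreSum = ∑_u p(u) qTerm` — the rational number `φ_{J,τ}(s)`.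

## The `p`-adic numbers

`lg j = log_p αⱼ := plog αⱼ ∈ ℚ_p` (`PadicLogPrincipalUnits.lean`: `exp (lg j) = αⱼ`,
`‖lg j‖ = ‖αⱼ − 1‖ ≤ p⁻¹`), `Λ`, `Λ₀` (`‖Λ‖ = ‖b_θ‖_p ‖Λ₀‖`, `‖Λ‖ = ‖∏ αⱼ^{bⱼ} θ^{b_θ} − 1‖`),
the exponents `ψ_u = ∑ λⱼ lg j + λ_θ lg θ` and `expo u = ψ_u + λ_θ Λ₀ = ∑ γⱼ lg j` of norm `≤ p⁻¹`,
and `exp (s ψ_u) = qE(u,s)`, `exp (s ψ_u / 2) = ∏ psqrt(αⱼ)^{λⱼ s} psqrt(θ)^{λ_θ s}` (the values at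
the half-integers, on the principal square roots). The functions are in `PadicCW77Functions.lean`.

## References
* [Yu1990] K. Yu, *Linear forms in p-adic logarithms II*, Compositio Math. 74 (1990), §§1–3.
* [CijsouwWaldschmidt1977] P. L. Cijsouw, M. Waldschmidt, *Linear forms and simultaneous
  approximations*, Compositio Math. 34 (1977), §4.
-/

noncomputable section

open NormedSpace Finset IsUltrametricDist
open Literature.NumberTheory.Transcendental.Baker1975 (bump bump_apply sum_bump)
open scoped Nat

namespace Literature.NumberTheory.Transcendental

namespace PadicCW77

open CW77.Setup (Idx Tau tauNorm bump0 bumpj bumpτ tauNorm_bumpτ)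

/-! ### The product formula for rationals, in the form used by the Liouville step -/

/-- `1/n ≤ ‖n‖_p` for a natural number `n ≠ 0` (`‖n‖_p = p^{-v_p(n)}` and `p^{v_p(n)} ∣ n`).
[cite: Yu1990, Lemma 2.5] -/
theorem one_div_le_norm_natCast {p : ℕ} [Fact p.Prime] {n : ℕ} (hn : n ≠ 0) :
    (1 : ℝ) / n ≤ ‖(n : ℚ_[p])‖ := by
  have hp : p.Prime := Fact.out
  have hne : (n : ℚ_[p]) ≠ 0 := by exact_mod_cast hn
  rw [Padic.norm_eq_zpow_neg_valuation hne, Padic.valuation_natCast, zpow_neg, zpow_natCast,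
    one_div]
  refine inv_anti₀ (pow_pos (by exact_mod_cast hp.pos) _) ?_
  have hdvd : p ^ padicValNat p n ∣ n := pow_padicValNat_dvd
  exact_mod_cast Nat.le_of_dvd (Nat.pos_of_ne_zero hn) hdvd

/-- `1/|m| ≤ ‖m‖_p` for an integer `m ≠ 0`. [cite: Yu1990, Lemma 2.5] -/
theorem one_div_le_norm_intCast {p : ℕ} [Fact p.Prime] {m : ℤ} (hm : m ≠ 0) :
    (1 : ℝ) / |(m : ℝ)| ≤ ‖(m : ℚ_[p])‖ := by
  have h := one_div_le_norm_natCast (p := p) (n := m.natAbs) (Int.natAbs_ne_zero.mpr hm)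
  have e1 : ((m.natAbs : ℕ) : ℝ) = |(m : ℝ)| := by rw [Nat.cast_natAbs, Int.cast_abs]
  have e2 : ‖((m.natAbs : ℕ) : ℚ_[p])‖ = ‖(m : ℚ_[p])‖ := by
    rcases Int.natAbs_eq m with h' | h'
    · conv_rhs => rw [h']
      simp
    · conv_rhs => rw [h']
      simp
  rw [e1] at h; rwa [e2] at h

/-- **The Liouville step at a rational point (product formula)**: if `c ∈ ℚ`, `D c ∈ ℤ` for a
natural number `0 < D ≤ Dmax`, `|c| ≤ M`, and `‖c‖_p < 1/(Dmax · M)`, then `c = 0`.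
[cite: Yu1990, Lemma 2.5] -/
theorem Rat.eq_zero_of_padicNorm_lt {p : ℕ} [Fact p.Prime] {c : ℚ} {D : ℕ} (hD : 0 < D)
    {Dmax M : ℝ} (hDle : (D : ℝ) ≤ Dmax) {m : ℤ} (hm : (D : ℚ) * c = m) (hM : |(c : ℝ)| ≤ M)
    (hlt : ‖(c : ℚ_[p])‖ < 1 / (Dmax * M)) : c = 0 := by
  by_contra hc
  have hDmax : 0 < Dmax := lt_of_lt_of_le (by exact_mod_cast hD) hDle
  have hm0 : m ≠ 0 := by
    intro h0; rw [h0, Int.cast_zero, mul_eq_zero] at hm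
    rcases hm with h | h
    · exact (Nat.cast_ne_zero.mpr hD.ne') h
    · exact hc h
  have hMpos : 0 < M := by
    refine (lt_or_ge 0 M).resolve_right fun hM0 => hc ?_
    have : |(c : ℝ)| ≤ 0 := hM.trans hM0
    exact_mod_cast abs_nonpos_iff.mp this
  -- `|m| ≤ D M`
  have hmabs : |(m : ℝ)| ≤ D * M := by
    have : (m : ℝ) = (D : ℝ) * c := by exact_mod_cast hm.symm
    rw [this, abs_mul, Nat.abs_cast]
    exact mul_le_mul_of_nonneg_left hM (Nat.cast_nonneg _)
  -- `‖c‖_p ≥ ‖m‖_p ≥ 1/|m| ≥ 1/(D M) ≥ 1/(Dmax M)`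
  have hcm : ‖(m : ℚ_[p])‖ ≤ ‖(c : ℚ_[p])‖ := by
    have : (m : ℚ_[p]) = (D : ℚ_[p]) * (c : ℚ_[p]) := by
      have := congrArg (fun q : ℚ => (q : ℚ_[p])) hm; push_cast at this; exact this.symm
    rw [this, norm_mul]
    exact mul_le_of_le_one_left (norm_nonneg _) (by exact_mod_cast Padic.norm_int_le_one (p := p) D)
  have hlow : 1 / (Dmax * M) ≤ ‖(c : ℚ_[p])‖ := by
    refine le_trans ?_ ((one_div_le_norm_intCast (p := p) hm0).trans hcm)
    rw [one_div_le_one_div (by positivity) (abs_pos.mpr (by exact_mod_cast hm0))]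
    exact hmabs.trans (mul_le_mul_of_nonneg_right hDle hMpos.le)
  exact absurd hlt (not_lt.mpr hlow)

/-! ### The data -/

/-- **The data of the `p`-adic Proposition over `ℚ`**: an odd prime `p`, `d` free rational
principal units `αⱼ ≡ 1 (mod p)`, the eliminated principal unit `θ`, integer coefficients `bⱼ`
and `b_θ ≠ 0` of minimal `p`-adic order. [cite: Yu1990, §1.1 and Theorem 1] -/
structure Setup where
  /-- the prime -/
  p : ℕ
  /-- it is prime -/
  hp : p.Prime
  /-- it is odd -/
  hp3 : 3 ≤ p
  /-- the number of free generators -/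
  d : ℕ
  /-- the free generators -/
  α : Fin d → ℚ
  /-- the eliminated generator -/
  θ : ℚ
  /-- the coefficients of the free logarithms -/
  b : Fin d → ℤ
  /-- the coefficient of `log_p θ` -/
  bθ : ℤ
  /-- it is non-zero -/
  bθ_ne : bθ ≠ 0
  /-- it has MINIMAL `p`-adic order among the non-zero coefficients (Yu's normalisation
  `ord_p b_n = min ord_p bⱼ`), so that the `βⱼ = −bⱼ/b_θ` are `p`-adic integers -/
  hbmin : ∀ j, b j ≠ 0 → padicValInt p bθ ≤ padicValInt p (b j)
  /-- the free generators are principal units -/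
  hα : ∀ j, 1 ≤ padicValRat p (α j - 1)
  /-- the eliminated generator is a principal unit -/
  hθ : 1 ≤ padicValRat p (θ - 1)

namespace Setup

variable (S : Setup)

/-- The prime of the set-up, as a `Fact` (for `ℚ_[S.p]`). [cite: Yu1990, §1.1] -/
instance : Fact S.p.Prime := ⟨S.hp⟩

/-- **The frame**: the `CW77.Setup` with the same `d, b, b_θ` and unit generators, through which
all generator-free bookkeeping (`Idx`, `Tau`, `β`, `γ`, `qΔ`, `qA`, boxes) is imported.
[cite: CijsouwWaldschmidt1977, §4 (p. 184)] -/
abbrev frame : CW77.Setup := ⟨S.d, fun _ => 1, 1, fun _ => one_pos, one_pos, S.b, S.bθ, S.bθ_ne⟩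

/-- The frame has the same `d`. [cite: CijsouwWaldschmidt1977, §4 (pp. 183–186)] -/
@[simp] theorem frame_d : S.frame.d = S.d := rfl

/-- The frame has the same `b`. [cite: CijsouwWaldschmidt1977, §4 (pp. 183–186)] -/
@[simp] theorem frame_b : S.frame.b = S.b := rfl

/-- The frame has the same `b_θ`. [cite: CijsouwWaldschmidt1977, §4 (pp. 183–186)] -/
@[simp] theorem frame_bθ : S.frame.bθ = S.bθ := rfl

/-- `βⱼ = −bⱼ/b_θ`. [cite: CijsouwWaldschmidt1977, Prop 1 (p. 183)] -/
theorem frame_β (j : Fin S.d) : S.frame.β j = -(S.b j : ℚ) / S.bθ := rfl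

/-- All `d + 1` generators: `αⱼ` (`j < d`) and `θ` (last). [cite: Yu1990, Theorem 1] -/
def all : Fin (S.d + 1) → ℚ := Fin.snoc S.α S.θ

/-- All generators are principal units. [cite: Yu1990, §1.1] -/
theorem one_le_padicValRat_all (i : Fin (S.d + 1)) : 1 ≤ padicValRat S.p (S.all i - 1) := by
  unfold all
  refine Fin.lastCases ?_ (fun j => ?_) i
  · rw [Fin.snoc_last]; exact S.hθ
  · rw [Fin.snoc_castSucc]; exact S.hα j

/-- A principal unit is `≠ 0`. [cite: CijsouwWaldschmidt1977, §4 (pp. 183–186)] -/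
theorem ne_zero_of_one_le_padicValRat {x : ℚ} (h : 1 ≤ padicValRat S.p (x - 1)) : x ≠ 0 := by
  rintro rfl
  rw [zero_sub, padicValRat.neg, padicValRat.one] at h
  exact absurd h (by norm_num)

/-- A principal unit (in our sense) is `≠ 1`. [cite: CijsouwWaldschmidt1977, §4 (pp. 183–186)] -/
theorem ne_one_of_one_le_padicValRat {x : ℚ} (h : 1 ≤ padicValRat S.p (x - 1)) : x ≠ 1 := by
  rintro rfl
  rw [sub_self, padicValRat.zero] at h
  exact absurd h (by norm_num)

/-- `αⱼ ≠ 0`. [cite: CijsouwWaldschmidt1977, §4 (pp. 183–186)] -/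
theorem α_ne (j : Fin S.d) : S.α j ≠ 0 := S.ne_zero_of_one_le_padicValRat (S.hα j)

/-- `θ ≠ 0`. [cite: CijsouwWaldschmidt1977, §4 (pp. 183–186)] -/
theorem θ_ne : S.θ ≠ 0 := S.ne_zero_of_one_le_padicValRat S.hθ

/-- `allᵢ ≠ 0`. [cite: CijsouwWaldschmidt1977, §4 (pp. 183–186)] -/
theorem all_ne (i : Fin (S.d + 1)) : S.all i ≠ 0 :=
  S.ne_zero_of_one_le_padicValRat (S.one_le_padicValRat_all i)

/-! ### The rational cores (generator-dependent twins of `CW77.Setup.qE/qTerm/coreSum`) -/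

variable {h Lb : ℕ}

/-- `qE(u, s) = ∏ⱼ αⱼ^{λⱼ s} · θ^{λ_θ s}` (rational; the value `exp(s ψ_u)`).
[cite: CijsouwWaldschmidt1977, §4 (p. 186)] -/
def qE (u : Idx S.d h Lb) (s : ℕ) : ℚ := (∏ j, S.α j ^ (u.2.1 j * s)) * S.θ ^ (u.2.2 * s)

/-- `qE ≠ 0`. [cite: CijsouwWaldschmidt1977, §4 (pp. 183–186)] -/
theorem qE_ne (u : Idx S.d h Lb) (s : ℕ) : S.qE u s ≠ 0 :=
  mul_ne_zero (prod_ne_zero_iff.mpr fun j _ => pow_ne_zero _ (S.α_ne j)) (pow_ne_zero _ S.θ_ne)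

/-- The rational core of one term at a natural point: `qΔ · qA · qE` (`qΔ`, `qA` of the frame).
[cite: CijsouwWaldschmidt1977, §4 (p. 186)] -/
def qTerm (J₀ J : ℕ) (u : Idx S.d h Lb) (τ : Tau S.d) (s : ℕ) : ℚ :=
  S.frame.qΔ J₀ J u τ.1 s * S.frame.qA u τ.2 * S.qE u s

/-- **The rational core `φ_{J,τ}(s) = ∑_{u ∈ box} p(u) · qΔ qA qE`.**
[cite: CijsouwWaldschmidt1977, §4 (p. 186)] -/
def coreSum (J₀ J : ℕ) (box : Finset (Idx S.d h Lb)) (p : Idx S.d h Lb → ℤ) (τ : Tau S.d)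
    (s : ℕ) : ℚ :=
  ∑ u ∈ box, (p u : ℚ) * S.qTerm J₀ J u τ s

/-! ### `p`-adic norms of the rational data -/

/-- `‖x‖_p = p^{−ord_p x}` for a non-zero rational. [cite: CijsouwWaldschmidt1977, §4 (pp. 183–186)] -/
theorem norm_ratCast_eq {x : ℚ} (hx : x ≠ 0) :
    ‖(x : ℚ_[S.p])‖ = (S.p : ℝ) ^ (-padicValRat S.p x) := by
  rw [Padic.norm_eq_zpow_neg_valuation (by exact_mod_cast hx), Padic.valuation_ratCast]

/-- `p⁻¹ < 1` and friends: `1 < p` as a real number. [cite: CijsouwWaldschmidt1977, §4 (pp. 183–186)] -/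
theorem one_lt_p : (1 : ℝ) < S.p := by exact_mod_cast S.hp.one_lt

/-- **A principal unit has `‖x − 1‖_p ≤ p⁻¹`.** [cite: Yu1990, §1.1] -/
theorem norm_sub_one_le {x : ℚ} (h : 1 ≤ padicValRat S.p (x - 1)) :
    ‖(x : ℚ_[S.p]) - 1‖ ≤ (S.p : ℝ)⁻¹ := by
  have hx1 : x - 1 ≠ 0 := sub_ne_zero.mpr (S.ne_one_of_one_le_padicValRat h)
  have e : (x : ℚ_[S.p]) - 1 = ((x - 1 : ℚ) : ℚ_[S.p]) := by push_cast; ring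
  rw [e, S.norm_ratCast_eq hx1, ← zpow_neg_one]
  exact zpow_le_zpow_right₀ S.one_lt_p.le (by linarith)

/-- `‖1 − αⱼ‖ ≤ p⁻¹`. [cite: Yu1990, §1.1] -/
theorem norm_one_sub_α_le (j : Fin S.d) : ‖1 - (S.α j : ℚ_[S.p])‖ ≤ (S.p : ℝ)⁻¹ := by
  rw [norm_sub_rev]; exact S.norm_sub_one_le (S.hα j)

/-- `‖1 − θ‖ ≤ p⁻¹`. [cite: Yu1990, §1.1] -/
theorem norm_one_sub_θ_le : ‖1 - (S.θ : ℚ_[S.p])‖ ≤ (S.p : ℝ)⁻¹ := by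
  rw [norm_sub_rev]; exact S.norm_sub_one_le S.hθ

/-- `‖1 − allᵢ‖ ≤ p⁻¹`. [cite: Yu1990, §1.1] -/
theorem norm_one_sub_all_le (i : Fin (S.d + 1)) : ‖1 - (S.all i : ℚ_[S.p])‖ ≤ (S.p : ℝ)⁻¹ := by
  rw [norm_sub_rev]; exact S.norm_sub_one_le (S.one_le_padicValRat_all i)

/-- `‖b_θ‖_p ≤ 1`. [cite: CijsouwWaldschmidt1977, §4 (pp. 183–186)] -/
theorem norm_bθ_le : ‖(S.bθ : ℚ_[S.p])‖ ≤ 1 := Padic.norm_int_le_one _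

/-- `0 < ‖b_θ‖_p`. [cite: CijsouwWaldschmidt1977, §4 (pp. 183–186)] -/
theorem norm_bθ_pos : 0 < ‖(S.bθ : ℚ_[S.p])‖ :=
  norm_pos_iff.mpr (by exact_mod_cast S.bθ_ne)

/-- **`‖βⱼ‖_p ≤ 1`** (`ord_p b_θ ≤ ord_p bⱼ`). [cite: Yu1990, Theorem 1] -/
theorem norm_β_le (j : Fin S.d) : ‖(S.frame.β j : ℚ_[S.p])‖ ≤ 1 := by
  rw [S.frame_β]; push_cast
  rw [norm_div, norm_neg]
  by_cases hj : S.b j = 0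
  · rw [hj]; simp
  refine div_le_one_of_le₀ ?_ (norm_nonneg _)
  have h1 : ‖((S.b j : ℚ) : ℚ_[S.p])‖ ≤ ‖((S.bθ : ℚ) : ℚ_[S.p])‖ := by
    rw [S.norm_ratCast_eq (by exact_mod_cast hj), S.norm_ratCast_eq (by exact_mod_cast S.bθ_ne),
      padicValRat.of_int, padicValRat.of_int]
    exact zpow_le_zpow_right₀ S.one_lt_p.le (neg_le_neg (Int.ofNat_le.mpr (S.hbmin j hj)))
  simpa using h1

/-- `‖γⱼ(u)‖_p ≤ 1`. [cite: CijsouwWaldschmidt1977, §4 (pp. 183–186)] -/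
theorem norm_γ_le (u : Idx S.d h Lb) (j : Fin S.d) : ‖(S.frame.γ u j : ℚ_[S.p])‖ ≤ 1 := by
  unfold CW77.Setup.γ; push_cast
  refine (norm_add_le_max _ _).trans (max_le ?_ ?_)
  · exact_mod_cast Padic.norm_int_le_one (p := S.p) (u.2.1 j : ℤ)
  · rw [norm_mul]
    refine mul_le_one₀ ?_ (norm_nonneg _) (S.norm_β_le j)
    exact_mod_cast Padic.norm_int_le_one (p := S.p) (u.2.2 : ℤ)

/-- `‖qA(u, τ')‖_p ≤ 1`. [cite: CijsouwWaldschmidt1977, §4 (pp. 183–186)] -/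
theorem norm_qA_le (u : Idx S.d h Lb) (τ' : Fin S.d → ℕ) : ‖(S.frame.qA u τ' : ℚ_[S.p])‖ ≤ 1 := by
  unfold CW77.Setup.qA; push_cast
  rw [norm_prod]
  exact prod_le_one (fun j _ => norm_nonneg _) fun j _ => by
    rw [norm_pow]; exact pow_le_one₀ (norm_nonneg _) (S.norm_γ_le u j)

/-- `‖qE(u, s)‖_p = 1` (the generators are units). [cite: CijsouwWaldschmidt1977, §4 (pp. 183–186)] -/
theorem norm_qE (u : Idx S.d h Lb) (s : ℕ) : ‖(S.qE u s : ℚ_[S.p])‖ = 1 := by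
  have hu : ∀ i : Fin (S.d + 1), ‖(S.all i : ℚ_[S.p])‖ = 1 := fun i =>
    IwasawaLog.norm_eq_one_of_norm_one_sub_lt
      ((S.norm_one_sub_all_le i).trans_lt (inv_lt_one_of_one_lt₀ S.one_lt_p))
  have hα : ∀ j, ‖(S.α j : ℚ_[S.p])‖ = 1 := fun j => by
    have := hu (Fin.castSucc j); unfold all at this; rwa [Fin.snoc_castSucc] at this
  have hθ : ‖(S.θ : ℚ_[S.p])‖ = 1 := by
    have := hu (Fin.last S.d); unfold all at this; rwa [Fin.snoc_last] at this
  unfold qE; push_cast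
  rw [norm_mul, norm_prod, norm_pow, hθ, one_pow, mul_one]
  exact prod_eq_one fun j _ => by rw [norm_pow, hα, one_pow]

/-! ### The logarithms -/

/-- `lg j = log_p αⱼ ∈ ℚ_p` (the logarithmic series of the principal unit `αⱼ`). [cite: Yu1990, §1.1] -/
def lg (j : Fin S.d) : ℚ_[S.p] := PadicExp.plog (S.α j : ℚ_[S.p])

/-- `lgθ = log_p θ`. [cite: Yu1990, §1.1] -/
def lgθ : ℚ_[S.p] := PadicExp.plog (S.θ : ℚ_[S.p])

/-- `log_p allᵢ`: `lg j` (`j < d`) and `lgθ` (last). [cite: Yu1990, §1.1] -/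
def lgAll (i : Fin (S.d + 1)) : ℚ_[S.p] := PadicExp.plog (S.all i : ℚ_[S.p])

/-- `lgAll (castSucc j) = lg j`. [cite: CijsouwWaldschmidt1977, §4 (pp. 183–186)] -/
@[simp] theorem lgAll_castSucc (j : Fin S.d) : S.lgAll (Fin.castSucc j) = S.lg j := by
  unfold lgAll lg all; rw [Fin.snoc_castSucc]

/-- `lgAll last = lgθ`. [cite: CijsouwWaldschmidt1977, §4 (pp. 183–186)] -/
@[simp] theorem lgAll_last : S.lgAll (Fin.last S.d) = S.lgθ := by
  unfold lgAll lgθ all; rw [Fin.snoc_last]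

/-- **`‖log_p allᵢ‖ = ‖allᵢ − 1‖ ≤ p⁻¹`.** [cite: Yu1990, §1.1] -/
theorem norm_lgAll_le (i : Fin (S.d + 1)) : ‖S.lgAll i‖ ≤ (S.p : ℝ)⁻¹ := by
  unfold lgAll
  rw [PadicExp.norm_plog S.hp3 (S.norm_one_sub_all_le i)]
  exact S.norm_one_sub_all_le i

/-- `‖lg j‖ ≤ p⁻¹`. [cite: Yu1990, §1.1] -/
theorem norm_lg_le (j : Fin S.d) : ‖S.lg j‖ ≤ (S.p : ℝ)⁻¹ := by
  rw [← S.lgAll_castSucc]; exact S.norm_lgAll_le _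

/-- `‖lgθ‖ ≤ p⁻¹`. [cite: Yu1990, §1.1] -/
theorem norm_lgθ_le : ‖S.lgθ‖ ≤ (S.p : ℝ)⁻¹ := by
  rw [← S.lgAll_last]; exact S.norm_lgAll_le _

/-- **`exp (log_p allᵢ) = allᵢ`.** [cite: Yu1990, §1.1] -/
theorem exp_lgAll (i : Fin (S.d + 1)) : exp (S.lgAll i) = (S.all i : ℚ_[S.p]) :=
  PadicExp.exp_plog S.hp3 (S.norm_one_sub_all_le i)

/-- `exp (s · log_p allᵢ) = allᵢˢ`. [cite: Yu1990, §1.1] -/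
theorem exp_natCast_mul_lgAll (i : Fin (S.d + 1)) (s : ℕ) :
    exp ((s : ℚ_[S.p]) * S.lgAll i) = (S.all i : ℚ_[S.p]) ^ s :=
  PadicExp.exp_natCast_mul_plog S.hp3 (S.norm_one_sub_all_le i) s

/-! ### The linear form -/

/-- **The linear form** `Λ = ∑ bⱼ log_p αⱼ + b_θ log_p θ ∈ ℚ_p`. [cite: Yu1990, Theorem 1] -/
def Λ : ℚ_[S.p] := ∑ j, (S.b j : ℚ_[S.p]) * S.lg j + (S.bθ : ℚ_[S.p]) * S.lgθ

/-- `Λ₀ = ∑ βⱼ log_p αⱼ − log_p θ` (`= −Λ/b_θ`). [cite: CijsouwWaldschmidt1977, Prop 1 (p. 183)] -/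
def Λ₀ : ℚ_[S.p] := ∑ j : Fin S.d, (S.frame.β j : ℚ_[S.p]) * S.lg j - S.lgθ

/-- `Λ = −b_θ Λ₀`. [cite: CijsouwWaldschmidt1977, §4 (pp. 183–186)] -/
theorem Λ_eq : S.Λ = -(S.bθ : ℚ_[S.p]) * S.Λ₀ := by
  have hb : (S.bθ : ℚ_[S.p]) ≠ 0 := by exact_mod_cast S.bθ_ne
  unfold Λ Λ₀
  have e : ∀ j : Fin S.d, (S.frame.β j : ℚ_[S.p]) * S.lg j = -((S.b j : ℚ_[S.p]) * S.lg j) / S.bθ := by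
    intro j; rw [S.frame_β]; push_cast; field_simp
  simp_rw [e]
  rw [← Finset.sum_div, Finset.sum_neg_distrib]
  field_simp
  ring

/-- **`‖Λ‖ = ‖b_θ‖_p · ‖Λ₀‖`.** [cite: CijsouwWaldschmidt1977, §4 (pp. 183–186)] -/
theorem norm_Λ_eq_mul : ‖S.Λ‖ = ‖(S.bθ : ℚ_[S.p])‖ * ‖S.Λ₀‖ := by
  rw [S.Λ_eq, norm_mul, norm_neg]

/-- `‖Λ‖ ≤ ‖Λ₀‖`. [cite: CijsouwWaldschmidt1977, §4 (pp. 183–186)] -/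
theorem norm_Λ_le : ‖S.Λ‖ ≤ ‖S.Λ₀‖ := by
  rw [S.norm_Λ_eq_mul]; exact mul_le_of_le_one_left (norm_nonneg _) S.norm_bθ_le

/-- The number `Θ = ∏ αⱼ^{bⱼ} θ^{b_θ} ∈ ℚ` whose distance to `1` is measured. [cite: Yu1990, Theorem 1] -/
def Θ : ℚ := (∏ j, S.α j ^ S.b j) * S.θ ^ S.bθ

/-- All `d + 1` exponents: `bⱼ` (`j < d`) and `b_θ` (last). [cite: CijsouwWaldschmidt1977, §4 (pp. 183–186)] -/
def ball : Fin (S.d + 1) → ℤ := Fin.snoc S.b S.bθ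

/-- `Θ = ∏ᵢ allᵢ^{ballᵢ}` in `ℚ_p`. [cite: CijsouwWaldschmidt1977, §4 (pp. 183–186)] -/
theorem Θ_eq_prod_all : (S.Θ : ℚ_[S.p]) = ∏ i : Fin (S.d + 1), (S.all i : ℚ_[S.p]) ^ S.ball i := by
  unfold Θ all ball
  rw [Fin.prod_univ_castSucc]
  simp only [Fin.snoc_castSucc, Fin.snoc_last]
  push_cast
  rfl

/-- **`Λ = log_p Θ`**: the linear form is the logarithm of `Θ = ∏ αⱼ^{bⱼ} θ^{b_θ}`.
[cite: Yu1990, §1.1] -/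
theorem Λ_eq_plog_Θ : S.Λ = PadicExp.plog (S.Θ : ℚ_[S.p]) := by
  have hlt : ∀ i : Fin (S.d + 1), ‖1 - (S.all i : ℚ_[S.p])‖ < 1 := fun i =>
    (S.norm_one_sub_all_le i).trans_lt (inv_lt_one_of_one_lt₀ S.one_lt_p)
  -- `Θ = ∏ᵢ allᵢ ^ ballᵢ` with `ball = snoc b bθ`
  rw [S.Θ_eq_prod_all, PadicExp.plog_prod_zpow (ℓ := S.p) univ _ _ fun i _ => hlt i]
  unfold Λ ball all
  rw [Fin.sum_univ_castSucc]
  simp only [Fin.snoc_castSucc, Fin.snoc_last]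
  rfl

/-- `Θ` is a principal unit: `‖1 − Θ‖_p ≤ p⁻¹`. [cite: Yu1990, §1.1] -/
theorem norm_one_sub_Θ_le : ‖1 - (S.Θ : ℚ_[S.p])‖ ≤ (S.p : ℝ)⁻¹ := by
  rw [S.Θ_eq_prod_all]
  exact PadicExp.norm_one_sub_prod_zpow_le (by positivity) (inv_lt_one_of_one_lt₀ S.one_lt_p)
    univ _ _ fun i _ => S.norm_one_sub_all_le i

/-- **`‖Λ‖ = ‖Θ − 1‖_p`**, i.e. `ord_p Λ = ord_p(∏ αⱼ^{bⱼ} θ^{b_θ} − 1)`. [cite: Yu1990, §1.1] -/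
theorem norm_Λ : ‖S.Λ‖ = ‖(S.Θ : ℚ_[S.p]) - 1‖ := by
  rw [S.Λ_eq_plog_Θ, PadicExp.norm_plog S.hp3 S.norm_one_sub_Θ_le, norm_sub_rev]

/-! ### The exponents of the auxiliary functions -/

/-- The exact exponent `ψ_u = ∑ λⱼ lg j + λ_θ lgθ` (of `φ`). [cite: CijsouwWaldschmidt1977, §4 (p. 185)] -/
def ψ (u : Idx S.d h Lb) : ℚ_[S.p] := ∑ j, (u.2.1 j : ℚ_[S.p]) * S.lg j + (u.2.2 : ℚ_[S.p]) * S.lgθ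

/-- The perturbed exponent `expo u = ψ_u + λ_θ Λ₀` (of `f`). [cite: CijsouwWaldschmidt1977, §4 (p. 184)] -/
def expo (u : Idx S.d h Lb) : ℚ_[S.p] := S.ψ u + (u.2.2 : ℚ_[S.p]) * S.Λ₀

/-- **The identity behind `f`**: `expo u = ∑ⱼ γⱼ(u) lg j`. [cite: CijsouwWaldschmidt1977, §4 (p. 184)] -/
theorem expo_eq (u : Idx S.d h Lb) :
    S.expo u = ∑ j : Fin S.d, (S.frame.γ u j : ℚ_[S.p]) * S.lg j := by
  unfold expo ψ Λ₀ CW77.Setup.γ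
  push_cast
  simp only [add_mul, sum_add_distrib, mul_sum, mul_sub]
  ring

/-- `‖ψ_u‖ ≤ p⁻¹`. [cite: Yu1990, §1.1] -/
theorem norm_ψ_le (u : Idx S.d h Lb) : ‖S.ψ u‖ ≤ (S.p : ℝ)⁻¹ := by
  unfold ψ
  refine (norm_add_le_max _ _).trans (max_le ?_ ?_)
  · refine IsUltrametricDist.norm_sum_le_of_forall_le_of_nonneg (by positivity) fun j _ => ?_
    rw [norm_mul]
    refine (mul_le_of_le_one_left (norm_nonneg _) ?_).trans (S.norm_lg_le j)
    exact_mod_cast Padic.norm_int_le_one (p := S.p) (u.2.1 j : ℤ)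
  · rw [norm_mul]
    refine (mul_le_of_le_one_left (norm_nonneg _) ?_).trans S.norm_lgθ_le
    exact_mod_cast Padic.norm_int_le_one (p := S.p) (u.2.2 : ℤ)

/-- `‖expo u‖ ≤ p⁻¹`. [cite: Yu1990, §1.1] -/
theorem norm_expo_le (u : Idx S.d h Lb) : ‖S.expo u‖ ≤ (S.p : ℝ)⁻¹ := by
  rw [S.expo_eq]
  refine IsUltrametricDist.norm_sum_le_of_forall_le_of_nonneg (by positivity) fun j _ => ?_
  rw [norm_mul]
  exact (mul_le_of_le_one_left (norm_nonneg _) (S.norm_γ_le u j)).trans (S.norm_lg_le j)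

/-- `‖λ_θ Λ₀‖ ≤ ‖Λ₀‖`. [cite: CijsouwWaldschmidt1977, §4 (pp. 183–186)] -/
theorem norm_natCast_mul_Λ₀_le (n : ℕ) : ‖(n : ℚ_[S.p]) * S.Λ₀‖ ≤ ‖S.Λ₀‖ := by
  rw [norm_mul]
  refine mul_le_of_le_one_left (norm_nonneg _) ?_
  exact_mod_cast Padic.norm_int_le_one (p := S.p) (n : ℤ)

/-- The exponents `λⱼ s` (`j < d`), `λ_θ s` (last) of one unknown at the point `s`. [cite: CijsouwWaldschmidt1977, §4 (pp. 183–186)] -/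
def expn (u : Idx S.d h Lb) (s : ℕ) : Fin (S.d + 1) → ℕ := Fin.snoc (fun j => u.2.1 j * s) (u.2.2 * s)

/-- `qE(u, s) = ∏ᵢ allᵢ^{expn(u,s)ᵢ}`. [cite: CijsouwWaldschmidt1977, §4 (pp. 183–186)] -/
theorem qE_eq_prod_all (u : Idx S.d h Lb) (s : ℕ) : S.qE u s = ∏ i, S.all i ^ S.expn u s i := by
  unfold qE all expn
  rw [Fin.prod_univ_castSucc]
  simp only [Fin.snoc_castSucc, Fin.snoc_last]

/-- `ψ_u · s = ∑ᵢ expn(u,s)ᵢ · log_p allᵢ`. [cite: CijsouwWaldschmidt1977, §4 (pp. 183–186)] -/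
theorem ψ_mul_natCast (u : Idx S.d h Lb) (s : ℕ) :
    S.ψ u * (s : ℚ_[S.p]) = ∑ i : Fin (S.d + 1), (S.expn u s i : ℚ_[S.p]) * S.lgAll i := by
  unfold ψ expn lgAll lg lgθ all
  rw [Fin.sum_univ_castSucc]
  simp only [Fin.snoc_castSucc, Fin.snoc_last]
  push_cast
  rw [add_mul, sum_mul]
  congr 1
  · exact sum_congr rfl fun j _ => by ring
  · ring

/-- **`exp (s ψ_u) = qE(u, s)`** at a natural number `s`. [cite: Yu1990, §2] -/
theorem exp_ψ_natCast (u : Idx S.d h Lb) (s : ℕ) :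
    exp (S.ψ u * (s : ℚ_[S.p])) = (S.qE u s : ℚ_[S.p]) := by
  rw [S.ψ_mul_natCast, PadicExp.exp_sum_of_norm_le S.hp3 univ _ fun i _ => ?_]
  · rw [S.qE_eq_prod_all]; push_cast
    exact prod_congr rfl fun i _ => S.exp_natCast_mul_lgAll i _
  · rw [norm_mul]
    refine (mul_le_of_le_one_left (norm_nonneg _) ?_).trans (S.norm_lgAll_le i)
    exact_mod_cast Padic.norm_int_le_one (p := S.p) (S.expn u s i : ℤ)

/-- **`exp (s ψ_u / 2) = ∏ᵢ psqrt(allᵢ)^{expn(u,s)ᵢ}`**: the value at the half-integer `s/2` lies on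
the principal square roots of the generators. [cite: Yu1990, §2] -/
theorem exp_ψ_half_natCast (u : Idx S.d h Lb) (s : ℕ) :
    exp (S.ψ u * ((2 : ℚ_[S.p])⁻¹ * (s : ℚ_[S.p]))) =
      ∏ i : Fin (S.d + 1), PadicExp.psqrt (S.all i : ℚ_[S.p]) ^ S.expn u s i := by
  have e : S.ψ u * ((2 : ℚ_[S.p])⁻¹ * (s : ℚ_[S.p])) =
      ∑ i : Fin (S.d + 1), (S.expn u s i : ℚ_[S.p]) * ((2 : ℚ_[S.p])⁻¹ * S.lgAll i) := by
    rw [show S.ψ u * ((2 : ℚ_[S.p])⁻¹ * (s : ℚ_[S.p])) = (2 : ℚ_[S.p])⁻¹ * (S.ψ u * s) by ring,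
      S.ψ_mul_natCast, mul_sum]
    exact sum_congr rfl fun i _ => by ring
  rw [e, PadicExp.exp_sum_of_norm_le S.hp3 univ _ fun i _ => ?_]
  · exact prod_congr rfl fun i _ =>
      PadicExp.exp_natCast_mul_half_plog S.hp3 (S.norm_one_sub_all_le i) _
  · rw [norm_mul]
    refine (mul_le_of_le_one_left (norm_nonneg _) ?_).trans ?_
    · exact_mod_cast Padic.norm_int_le_one (p := S.p) (S.expn u s i : ℤ)
    · unfold lgAll
      rw [PadicExp.norm_inv_two_mul_plog S.hp3 (S.norm_one_sub_all_le i)]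
      exact S.norm_one_sub_all_le i

end Setup

end PadicCW77

end Literature.NumberTheory.Transcendental

end
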